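import Summits.BirchSwinnertonDyer.BirchSwinnertonDyer.Theorems.AlignedTransportAtTwoMainConjectureTransportAlignedAtTwoKilfordCopyCrossLevelFactor
import Summits.BirchSwinnertonDyer.BirchSwinnertonDyer.Theorems.AlignedTransportAtTwoMainConjectureTransportAlignedAtTwoKilfordCopyCrossLevelFactorForms
import Summits.BirchSwinnertonDyer.BirchSwinnertonDyer.Theorems.AlignedTransportAtTwoMainConjectureTransportAlignedAtTwoKilfordCopyCrossLevel
import Literature.NumberTheory.EllipticCurves.RootNumberTwistProofs
import HarnessLib

/-!
# Crux C1 `MainConjectureTransportAlignedAtTwo` (stmt-BirchSwinnertonDyer-22296), line `birth`, residual (R2) `stub_lamLawKilford`, UNEQUAL conductors,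
# general «factor-and-absorb»: THE REDUCTION IN THE CRUX'S CURRENCY (`ModularParametrizationData`, `uniformize`, `W.LFunction`) and the
# conductor ↔ parity dictionary at a bad prime (width seat att-p3 g19; `--supports 22296`)

THEOREMS ONLY (no `def`, no `sorry`, no named fact). BSD is not proved by this; C1 is not closed by this.

* §1 **`uniformize_depleted_iff_of_factorForms`** — `…KilfordCopyCrossLevelFactor.sameKernel_depleted_of_sameKernel_factorForms` for parametrisation data
  `D₁, D₂`: same half-kernel at a common level `L` for the two generalised old forms `F₁, F₂` (given by their `q`-expansions,
  `…FactorForms.modularSymbol_factorForm`) ⟹ the conclusion of v27's inline cross-level stub `hCopyNe` for the pair (the `S`-depleted functionals at `N'`).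
* §2 Dictionary at a prime `ℓ` of `N(W)`: `odd_LFunction_of_dvd_of_not_sq_dvd` (`ℓ ∥ N ⟹ a_ℓ` odd), `LFunction_eq_zero_of_sq_dvd_conductorNorm`
  (`ℓ² ∣ N ⟹ a_ℓ = 0`); `prod_pow_dvd_of_forall_pow_dvd` (prime powers at distinct primes).

References: Greenberg–Vatsal 2000 §3 [GreenbergVatsal2000]; Cremona 1997 §2.4, §2.10 [CremonaAlgorithms1997]; Silverman ATAEC IV.10.2 [Silverman1994].
-/

noncomputable section

-- justification: the `Summit.BirchSwinnertonDyer.BirchSwinnertonDyer.…` path repeats a component (route-file convention)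
set_option linter.dupNamespace false
set_option autoImplicit false

open scoped MatrixGroups ModularForm Classical

open CongruenceSubgroup Complex WeierstrassCurve IsDedekindDomain
open Literature.NumberTheory.EllipticCurves Literature.NumberTheory.EllipticCurves.ModularForms
open Summit.BirchSwinnertonDyer.BirchSwinnertonDyer.Theorems.AlignedTransportAtTwoDeltaPosCongruenceInputs (odd_LFunction_iff_hasMultiplicativeReductionAtPrime)
open Summit.BirchSwinnertonDyer.BirchSwinnertonDyer.Theorems.AlignedTransportAtTwoKilfordCopyCrossLevelFactor
open Summit.BirchSwinnertonDyer.BirchSwinnertonDyer.Theorems.AlignedTransportAtTwoKilfordCopyCrossLevelFactorForms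

namespace Summit.BirchSwinnertonDyer.BirchSwinnertonDyer.Theorems.AlignedTransportAtTwoKilfordCopyCrossLevelFactorCurrency

/-! ## §1 The general reduction in the crux's currency -/

/-- **The cross-level hypothesis of (R2), EVERY conductor shape, from a common level.** Parametrisation data `D₁` (level `N₁`), `D₂` (level `N₂`);
`S` a set of odd primes; integer data `(β, ε)` (common factor) and `(ρᵢ, σᵢ)` with exponents `eᵢ` (side factors) satisfying the exactness and parity
constraints of `…Factor.sameKernel_depleted_of_sameKernel_factorForms` against `a_ℓ(Wᵢ)` and `𝟙_{ℓ∤Nᵢ}`; a common level `L` with `Nᵢ·∏ℓ^{eᵢ(ℓ)} ∣ L`;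
the generalised old forms `Fᵢ ∈ S₂(Γ₀(L))` given by their `q`-expansions `a_n(Fᵢ) = Rᵢ.coeff.sum (c, m ↦ c·m·𝟙_{m∣n}·a_{n/m}(fᵢ))`; the `S`-depleted
forms `gᵢ` at a level `N'` with `Nᵢ∏ℓ² ∣ N'`, `L∏ℓ² ∣ N'`. IF `u₁(c₁·y(F₁)/2) = O ↔ u₂(c₂·y(F₂)/2) = O` for every `y ∈ H₁(X₀(L);ℤ)` THEN
`u₁(c₁·∏ℓ²·x(g₁)/2) = O ↔ u₂(c₂·∏ℓ²·x(g₂)/2) = O` for every `x ∈ H₁(X₀(N');ℤ)`. [cite: GreenbergVatsal2000, §3] [cite: CremonaAlgorithms1997, §2.4 and §2.10] -/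
theorem uniformize_depleted_iff_of_factorForms
    {W₁ W₂ : WeierstrassCurve ℚ} {N₁ N₂ L : ℕ} [NeZero N₁] [NeZero N₂] [NeZero L]
    (D₁ : ModularParametrizationData W₁ N₁) (D₂ : ModularParametrizationData W₂ N₂)
    (S : Finset ℕ) (hS : ∀ ℓ ∈ S, ℓ.Prime) (hSodd : ∀ ℓ ∈ S, Odd ℓ)
    (β ε ρ₁ σ₁ ρ₂ σ₂ : ℕ → ℤ) (e₁ e₂ : ℕ → ℕ)
    (hx₁ : ∀ ℓ ∈ S, β ℓ * σ₁ ℓ + ε ℓ * ρ₁ ℓ = 0) (hx₁' : ∀ ℓ ∈ S, ε ℓ * σ₁ ℓ = 0)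
    (hx₂ : ∀ ℓ ∈ S, β ℓ * σ₂ ℓ + ε ℓ * ρ₂ ℓ = 0) (hx₂' : ∀ ℓ ∈ S, ε ℓ * σ₂ ℓ = 0)
    (hb₁ : ∀ ℓ ∈ S, (2 : ℤ) ∣ -W₁.LFunction ℓ - (β ℓ + ρ₁ ℓ))
    (he₁ : ∀ ℓ ∈ S, (2 : ℤ) ∣ (if ℓ ∣ N₁ then 0 else 1) - (ε ℓ + β ℓ * ρ₁ ℓ + σ₁ ℓ))
    (hb₂ : ∀ ℓ ∈ S, (2 : ℤ) ∣ -W₂.LFunction ℓ - (β ℓ + ρ₂ ℓ))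
    (he₂ : ∀ ℓ ∈ S, (2 : ℤ) ∣ (if ℓ ∣ N₂ then 0 else 1) - (ε ℓ + β ℓ * ρ₂ ℓ + σ₂ ℓ))
    (hρ₁ : ∀ ℓ ∈ S, e₁ ℓ = 0 → ρ₁ ℓ = 0) (hσ₁ : ∀ ℓ ∈ S, e₁ ℓ ≤ 1 → σ₁ ℓ = 0) (hL₁ : N₁ * ∏ ℓ ∈ S, ℓ ^ e₁ ℓ ∣ L)
    (hρ₂ : ∀ ℓ ∈ S, e₂ ℓ = 0 → ρ₂ ℓ = 0) (hσ₂ : ∀ ℓ ∈ S, e₂ ℓ ≤ 1 → σ₂ ℓ = 0) (hL₂ : N₂ * ∏ ℓ ∈ S, ℓ ^ e₂ ℓ ∣ L)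
    (N' : ℕ) [NeZero N'] (hN₁' : N₁ * ∏ ℓ ∈ S, ℓ ^ 2 ∣ N') (hN₂' : N₂ * ∏ ℓ ∈ S, ℓ ^ 2 ∣ N') (hL' : L * ∏ ℓ ∈ S, ℓ ^ 2 ∣ N')
    (g₁ g₂ : CuspForm (Gamma0 N') 2)
    (hg₁ : ∀ n, cuspCoeff g₁ n = if ∃ ℓ ∈ S, ℓ ∣ n then 0 else cuspCoeff D₁.f n)
    (hg₂ : ∀ n, cuspCoeff g₂ n = if ∃ ℓ ∈ S, ℓ ∣ n then 0 else cuspCoeff D₂.f n)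
    (F₁ F₂ : CuspForm (Gamma0 L) 2)
    (hF₁ : ∀ n, cuspCoeff F₁ n = ((∏ ℓ ∈ S, (MonoidAlgebra.single 1 (1 : ℂ) + MonoidAlgebra.single ℓ ((ρ₁ ℓ : ℤ) : ℂ) +
      MonoidAlgebra.single (ℓ ^ 2) ((σ₁ ℓ : ℤ) : ℂ)) : MonoidAlgebra ℂ ℕ).coeff.sum
        fun m c ↦ c * ((m : ℂ) * if m ∣ n then cuspCoeff D₁.f (n / m) else 0)))
    (hF₂ : ∀ n, cuspCoeff F₂ n = ((∏ ℓ ∈ S, (MonoidAlgebra.single 1 (1 : ℂ) + MonoidAlgebra.single ℓ ((ρ₂ ℓ : ℤ) : ℂ) +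
      MonoidAlgebra.single (ℓ ^ 2) ((σ₂ ℓ : ℤ) : ℂ)) : MonoidAlgebra ℂ ℕ).coeff.sum
        fun m c ↦ c * ((m : ℂ) * if m ∣ n then cuspCoeff D₂.f (n / m) else 0)))
    (hker : ∀ y ∈ periodHomology L,
      D₁.uniformize ((D₁.c : ℂ) * y F₁ / 2) = 0 ↔ D₂.uniformize ((D₂.c : ℂ) * y F₂ / 2) = 0) :
    ∀ x ∈ periodHomology N',
      D₁.uniformize ((D₁.c : ℂ) * ((((∏ ℓ ∈ S, ℓ ^ 2 : ℕ) : ℂ) * x g₁) / 2)) = 0 ↔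
        D₂.uniformize ((D₂.c : ℂ) * ((((∏ ℓ ∈ S, ℓ ^ 2 : ℕ) : ℂ) * x g₂) / 2)) = 0 := by
  intro x hx
  rw [D₁.uniformize_eq_zero_iff, D₂.uniformize_eq_zero_iff, ← mul_div_assoc, ← mul_div_assoc]
  have hS0 : ∀ ℓ ∈ S, ℓ ≠ 0 := fun ℓ hℓ ↦ (hS ℓ hℓ).ne_zero
  have hT₁ : ∀ (p : ℕ) (hp : p.Prime), (haveI : NeZero p := ⟨hp.ne_zero⟩; heckeT (Gamma0 N₁) 2 p D₁.f) = cuspCoeff D₁.f p • D₁.f :=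
    fun p hp ↦ by haveI : NeZero p := ⟨hp.ne_zero⟩; exact D₁.isNewformOf.1.heckeT_eq_coeff_smul hp
  have hT₂ : ∀ (p : ℕ) (hp : p.Prime), (haveI : NeZero p := ⟨hp.ne_zero⟩; heckeT (Gamma0 N₂) 2 p D₂.f) = cuspCoeff D₂.f p • D₂.f :=
    fun p hp ↦ by haveI : NeZero p := ⟨hp.ne_zero⟩; exact D₂.isNewformOf.1.heckeT_eq_coeff_smul hp
  have hker' : ∀ y ∈ periodHomology L,
      (D₁.c : ℂ) * y F₁ / 2 ∈ D₁.L.lattice.toAddSubgroup ↔ (D₂.c : ℂ) * y F₂ / 2 ∈ D₂.L.lattice.toAddSubgroup := by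
    intro y hy
    rw [Submodule.mem_toAddSubgroup, Submodule.mem_toAddSubgroup, ← D₁.uniformize_eq_zero_iff, ← D₂.uniformize_eq_zero_iff]
    exact hker y hy
  exact sameKernel_depleted_of_sameKernel_factorForms D₁.f D₂.f (fun n ↦ W₁.LFunction n) (fun n ↦ W₂.LFunction n)
    D₁.isNewformOf.2 D₂.isNewformOf.2 hT₁ hT₂ S hS hSodd β ε ρ₁ σ₁ ρ₂ σ₂ hx₁ hx₁' hx₂ hx₂' hb₁ he₁ hb₂ he₂ N' hN₁' hN₂' hL' g₁ g₂ hg₁ hg₂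
    F₁ F₂ (modularSymbol_factorForm D₁.f _ D₁.isNewformOf.2 ρ₁ σ₁ e₁ S hS0 hρ₁ hσ₁ hL₁ F₁ hF₁)
    (modularSymbol_factorForm D₂.f _ D₂.isNewformOf.2 ρ₂ σ₂ e₂ S hS0 hρ₂ hσ₂ hL₂ F₂ hF₂)
    D₁.L.lattice.toAddSubgroup D₂.L.lattice.toAddSubgroup D₁.c D₂.c
    (fun z hz ↦ D₁.smul_periodLattice_le z hz) (fun z hz ↦ D₂.smul_periodLattice_le z hz) hker' x hx

/-! ## §2 The dictionary at a bad prime: `ℓ ∥ N ⟹ a_ℓ` odd, `ℓ² ∣ N ⟹ a_ℓ = 0`; prime powers at distinct primes -/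

/-- **`ℓ ∥ N(W)` ⟹ multiplicative reduction ⟹ `a_ℓ(W)` odd** (`a_ℓ = ±1`). [cite: Silverman1994, IV.10.2 (b)] -/
theorem odd_LFunction_of_dvd_of_not_sq_dvd (W : WeierstrassCurve ℚ) [W.IsElliptic] {ℓ : ℕ} (hℓ : ℓ.Prime)
    (h₁ : ℓ ∣ W.conductorNorm ℤ) (h₂ : ¬ ℓ ^ 2 ∣ W.conductorNorm ℤ) : Odd (W.LFunction ℓ) := by
  haveI : Fact ℓ.Prime := ⟨hℓ⟩
  rw [odd_LFunction_iff_hasMultiplicativeReductionAtPrime W hℓ h₁,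
    W.hasMultiplicativeReductionAtPrime_iff_hasMultiplicativeReductionAt_holds ⟨ℓ, hℓ⟩]
  set v : HeightOneSpectrum ℤ := (Rat.HeightOneSpectrum.primesEquiv (R := ℤ)).symm ⟨ℓ, hℓ⟩ with hv
  have hgen : Rat.HeightOneSpectrum.natGenerator v = ℓ :=
    congrArg Subtype.val ((Rat.HeightOneSpectrum.primesEquiv (R := ℤ)).apply_symm_apply ⟨ℓ, hℓ⟩)
  have hbad : ¬ W.HasGoodReductionAt v := (natGenerator_dvd_conductorNorm_iff v W).mp (hgen ▸ h₁)
  have hnadd : ¬ W.HasAdditiveReductionAt v := fun h ↦ h₂ (hgen ▸ (natGenerator_sq_dvd_conductorNorm_iff v W).mpr h)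
  rcases hasGoodReductionAt_or_hasMultiplicativeReductionAt_or_hasAdditiveReductionAt v W with h | h | h
  · exact (hbad h).elim
  · exact h
  · exact (hnadd h).elim

/-- **`ℓ² ∣ N(W)` ⟹ additive reduction ⟹ `a_ℓ(W) = 0`** (the Euler factor at an additive prime is `1`). [cite: Silverman1994, IV.10.2 (c)] -/
theorem LFunction_eq_zero_of_sq_dvd_conductorNorm (W : WeierstrassCurve ℚ) [W.IsElliptic] {ℓ : ℕ} (hℓ : ℓ.Prime)
    (hsq : ℓ ^ 2 ∣ W.conductorNorm ℤ) : W.LFunction ℓ = 0 := by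
  haveI : Fact ℓ.Prime := ⟨hℓ⟩
  set v : HeightOneSpectrum ℤ := (Rat.HeightOneSpectrum.primesEquiv (R := ℤ)).symm ⟨ℓ, hℓ⟩ with hv
  have hgen : Rat.HeightOneSpectrum.natGenerator v = ℓ :=
    congrArg Subtype.val ((Rat.HeightOneSpectrum.primesEquiv (R := ℤ)).apply_symm_apply ⟨ℓ, hℓ⟩)
  have hadd : W.HasAdditiveReductionAt v := by
    rw [← natGenerator_sq_dvd_conductorNorm_iff v W, hgen]
    exact hsq
  rw [W.hasAdditiveReductionAt_int_iff_ringOfIntegers ⟨ℓ, hℓ⟩] at hadd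
  exact W.LFunction_apply_eq_zero_of_hasAdditiveReductionAt
    (v := (Rat.HeightOneSpectrum.primesEquiv (R := NumberField.RingOfIntegers ℚ)).symm ⟨ℓ, hℓ⟩)
    (by rw [Equiv.apply_symm_apply]) hadd (dvd_refl ℓ)

/-- **A product of prime powers at DISTINCT primes divides `K` as soon as each prime power does** (pairwise coprimality). [folklore] -/
theorem prod_pow_dvd_of_forall_pow_dvd (S : Finset ℕ) (hS : ∀ ℓ ∈ S, ℓ.Prime) (e : ℕ → ℕ) (K : ℕ) :
    (∀ ℓ ∈ S, ℓ ^ e ℓ ∣ K) → ∏ ℓ ∈ S, ℓ ^ e ℓ ∣ K := by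
  classical
  induction S using Finset.induction_on with
  | empty => intro _; simp
  | insert ℓ S hℓS ih =>
    intro h
    rw [Finset.prod_insert hℓS]
    have hcop : Nat.Coprime (ℓ ^ e ℓ) (∏ ℓ' ∈ S, ℓ' ^ e ℓ') := by
      refine Nat.Coprime.pow_left _ (Nat.coprime_prod_right_iff.mpr fun ℓ' hℓ' ↦ Nat.Coprime.pow_right _ ?_)
      exact (Nat.coprime_primes (hS ℓ (Finset.mem_insert_self ℓ S)) (hS ℓ' (Finset.mem_insert_of_mem hℓ'))).mpr
        (fun heq ↦ hℓS (heq ▸ hℓ'))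
    exact hcop.mul_dvd_of_dvd_of_dvd (h ℓ (Finset.mem_insert_self ℓ S))
      (ih (fun ℓ' hℓ' ↦ hS ℓ' (Finset.mem_insert_of_mem hℓ')) fun ℓ' hℓ' ↦ h ℓ' (Finset.mem_insert_of_mem hℓ'))

end Summit.BirchSwinnertonDyer.BirchSwinnertonDyer.Theorems.AlignedTransportAtTwoKilfordCopyCrossLevelFactorCurrency

end
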